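import Summits.QuantumFields.YangMills.Theses.DirichletWindow
import Summits.QuantumFields.YangMills.Theorems.XiCompleteMonotonicityRecords
import HarnessLib

/-!
# `XiDiverges` (item stmt-QuantumFields-8941) reduced to its windows

Support file for the statement item stmt-QuantumFields-8941,
`Summit.QuantumFields.YangMills.Theses.DirichletWindow.XiDiverges` (shared verbatim with route
`XiCompleteMonotonicity`): the qualitative payoff "ξ_lat(β) → ∞ uniformly over infinite-volume
torus-limit states" of Chatterjee's Problem 5.1 — for every `ε > 0` there is `β₁` such that for all
`β ≥ β₁` and every limit state `μ` at `β` the axial plaquette two-point function obeys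
`A e^{-m n} ≤ f_μ(n e₀)` for all `n`, with `A > 0` and `0 ≤ m ≤ ε`.

The statement itself is open (no weak-coupling control of plaquette covariances of a 4-d
non-abelian lattice gauge theory, uniformly over infinite-volume states, is in print). This file
records, kernel-checked, the *reductions* both routes plan to use:

* `xiDiverges_chord` — the real-variable core (chord inequality for a non-negative, non-increasing
  sequence that is log-convex from index `1` on): a lower bound at ONE scale `M + 2` against
  `e^{-ε (M+1)} a(1)` propagates to `a(M+2) e^{-ε k} ≤ a(k)` for every `k`;
* `xiDiverges_of_window` — `AxialLogConvexity` plus such a one-scale window in every limit state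
  gives `XiDiverges`;
* `xiDiverges_of_fixedDistanceLower` — `AxialLogConvexity → FixedDistanceLower →
  PlaquetteVarianceUpper → XiDiverges` (items 8940, 8938, 8939; the body of the glue item
  `XiDivergesOfFixedDistance`, 8943, whose two route declarations are then closed by
  `xiDivergesOfFixedDistance_dirichletWindow` / `xiDivergesOfFixedDistance_xiCompleteMonotonicity`);
* `xiDiverges_of_polynomialWindow` — `AxialLogConvexity → PolynomialWindow → XiDiverges`
  (items 8940, 8937; the body of route `XiCompleteMonotonicity`'s glue item
  `XiDivergesOfPolynomial`, 8942, closed by `xiDivergesOfPolynomial_xiCompleteMonotonicity`);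
* `xiDiverges_of_xiExpLowerBound` — route `XiCompleteMonotonicity`'s target (item 8935) implies it;
* `xiDiverges_iff_xiCompleteMonotonicity` — the two routes' declarations of the shared item agree.

So `XiDiverges` closes as soon as any of {8940 ∧ 8938 ∧ 8939}, {8940 ∧ 8937}, {8935} does; the
weak-coupling input itself (a lower bound on `f_μ(n e₀)/f_μ(e₀)` at one large separation,
uniformly over limit states) is the open content of items 8935–8939 and is not touched here.
No definition is introduced; simplicity of `G` is only carried through the hypotheses.
-/

namespace Summit.QuantumFields.YangMills.Theorems

open Real Filter Asymptotics
open Literature.MathematicalPhysics.QuantumFieldTheory Literature.MathematicalPhysics.QuantumLattice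

/-- **Chord lemma (real-variable core of the glue).** Let `a : ℕ → ℝ` be non-negative,
non-increasing and log-convex from index `1` on (`a(n+2)² ≤ a(n+1) a(n+3)`), and suppose that at
the scale `M + 2` it is positive and at least `e^{-ε (M+1)} a(1)` (`ε ≥ 0`). Then
`a(M+2) e^{-ε k} ≤ a(k)` for every `k`: below the scale by monotonicity, above it because the
ratios `a(j+2)/a(j+1)` are non-decreasing, so the last ratio inside the window, and hence every
later one, is at least `e^{-ε}`. [folklore] -/
theorem xiDiverges_chord {a : ℕ → ℝ} {ε : ℝ} {M : ℕ} (hε : 0 ≤ ε)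
    (h0 : ∀ n, 0 ≤ a n) (hmono : ∀ n, a (n + 1) ≤ a n)
    (hlc : ∀ n, a (n + 2) ^ 2 ≤ a (n + 1) * a (n + 3))
    (hpos : 0 < a (M + 2))
    (hwin : Real.exp (-(ε * (M + 1))) * a 1 ≤ a (M + 2)) :
    ∀ k : ℕ, a (M + 2) * Real.exp (-(ε * k)) ≤ a k := by
  have hanti : Antitone a := antitone_nat_of_succ_le hmono
  -- positivity of `a (j+1)` for all `j`: zeros of a log-convex tail propagate downwards
  have hpos12 : ∀ j, 0 < a (j + 1) ∧ 0 < a (j + 2) := by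
    intro j
    induction j with
    | zero =>
      exact ⟨hpos.trans_le (hanti (by omega)), hpos.trans_le (hanti (by omega))⟩
    | succ j ih =>
      refine ⟨ih.2, ?_⟩
      by_contra hneg
      have h3 : a (j + 3) = 0 := le_antisymm (not_lt.1 hneg) (h0 _)
      have h := hlc j
      rw [h3, mul_zero] at h
      have h2 : a (j + 2) = 0 := by nlinarith [ih.2]
      exact ih.2.ne' h2
  have hp : ∀ j, 0 < a (j + 1) := fun j => (hpos12 j).1
  -- the ratios `a (j+2) / a (j+1)` are non-decreasing
  have hr_mono : Monotone fun j => a (j + 2) / a (j + 1) := by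
    refine monotone_nat_of_le_succ fun j => ?_
    show a (j + 2) / a (j + 1) ≤ a (j + 1 + 2) / a (j + 1 + 1)
    rw [div_le_div_iff₀ (hp j) (hp (j + 1))]
    have h := hlc j
    nlinarith [h]
  have hstep : ∀ j, a (j + 2) = a (j + 2) / a (j + 1) * a (j + 1) := fun j => by
    rw [div_mul_cancel₀ _ (hp j).ne']
  have hrnn : ∀ j, 0 ≤ a (j + 2) / a (j + 1) := fun j => div_nonneg (h0 _) (h0 _)
  -- upper chord inside the window
  have hup : ∀ j, j ≤ M + 1 → a (j + 1) ≤ (a (M + 2) / a (M + 1)) ^ j * a 1 := by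
    intro j
    induction j with
    | zero => intro; simp
    | succ j ih =>
      intro hj
      have hrj : a (j + 2) / a (j + 1) ≤ a (M + 2) / a (M + 1) := hr_mono (show j ≤ M by omega)
      calc a (j + 1 + 1) = a (j + 2) / a (j + 1) * a (j + 1) := hstep j
        _ ≤ a (M + 2) / a (M + 1) * ((a (M + 2) / a (M + 1)) ^ j * a 1) :=
            mul_le_mul hrj (ih (by omega)) (h0 _) ((hrnn j).trans hrj)
        _ = (a (M + 2) / a (M + 1)) ^ (j + 1) * a 1 := by ring
  -- hence the last ratio inside the window is at least `e^{-ε}`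
  have hρ : Real.exp (-ε) ≤ a (M + 2) / a (M + 1) := by
    have h1 : Real.exp (-ε) ^ (M + 1) * a 1 ≤ (a (M + 2) / a (M + 1)) ^ (M + 1) * a 1 := by
      calc Real.exp (-ε) ^ (M + 1) * a 1 = Real.exp (-(ε * (M + 1))) * a 1 := by
              rw [← Real.exp_nat_mul]; congr 2; push_cast; ring
        _ ≤ a (M + 2) := hwin
        _ ≤ (a (M + 2) / a (M + 1)) ^ (M + 1) * a 1 := hup (M + 1) le_rfl
    have h2 : Real.exp (-ε) ^ (M + 1) ≤ (a (M + 2) / a (M + 1)) ^ (M + 1) :=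
      le_of_mul_le_mul_right h1 (hp 0)
    exact (pow_le_pow_iff_left₀ (Real.exp_pos _).le (hrnn M) (Nat.succ_ne_zero M)).1 h2
  -- lower chord beyond the window
  have hdown : ∀ j : ℕ, a (M + 2) * Real.exp (-(ε * j)) ≤ a (M + 2 + j) := by
    intro j
    induction j with
    | zero => simp
    | succ j ih =>
      have hrj : a (M + 2) / a (M + 1) ≤ a (M + j + 1 + 2) / a (M + j + 1 + 1) :=
        hr_mono (show M ≤ M + j + 1 by omega)
      have hidx : M + j + 1 + 2 = M + 2 + (j + 1) := by omega
      have hidx' : M + j + 1 + 1 = M + 2 + j := by omega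
      calc a (M + 2) * Real.exp (-(ε * ((j + 1 : ℕ) : ℝ)))
          = Real.exp (-ε) * (a (M + 2) * Real.exp (-(ε * j))) := by
              push_cast
              rw [show -(ε * ((j : ℝ) + 1)) = -ε + -(ε * j) by ring, Real.exp_add]; ring
        _ ≤ a (M + j + 1 + 2) / a (M + j + 1 + 1) * a (M + 2 + j) :=
              mul_le_mul (hρ.trans hrj) ih (by positivity) ((hrnn M).trans hrj)
        _ = a (M + 2 + (j + 1)) := by rw [← hidx, hidx', ← hidx', ← hstep (M + j + 1), hidx]
  intro k
  rcases le_or_gt k (M + 2) with hk | hk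
  · calc a (M + 2) * Real.exp (-(ε * k)) ≤ a (M + 2) * 1 := by
          refine mul_le_mul_of_nonneg_left ?_ (h0 _)
          rw [Real.exp_le_one_iff]
          nlinarith [hε, (Nat.cast_nonneg k : (0 : ℝ) ≤ k)]
      _ = a (M + 2) := mul_one _
      _ ≤ a k := hanti hk
  · obtain ⟨j, rfl⟩ : ∃ j, k = M + 2 + j := ⟨k - (M + 2), by omega⟩
    calc a (M + 2) * Real.exp (-(ε * ((M + 2 + j : ℕ) : ℝ)))
        ≤ a (M + 2) * Real.exp (-(ε * j)) := by
          refine mul_le_mul_of_nonneg_left (Real.exp_le_exp.2 ?_) (h0 _)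
          push_cast
          nlinarith [hε, (Nat.cast_nonneg M : (0 : ℝ) ≤ M), (Nat.cast_nonneg j : (0 : ℝ) ≤ j)]
      _ ≤ a (M + 2 + j) := hdown j

/-- **One-scale window ⇒ `XiDiverges`.** If the axial plaquette two-point function of every limit
state is non-negative, non-increasing and log-convex from separation `1` on (`AxialLogConvexity`,
the reflection-positivity half), then `XiDiverges` follows from a ONE-SCALE window: for every
`ε > 0`, eventually in `β`, every limit state `μ` has some scale `M + 2` at which
`f_μ((M+2) e₀) > 0` and `e^{-ε (M+1)} f_μ(e₀) ≤ f_μ((M+2) e₀)`. The scale may depend on `μ`;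
the constants of `XiDiverges` are `m := ε`, `A := f_μ((M+2) e₀)`. [folklore] -/
theorem xiDiverges_of_window
    (hRP : Theses.DirichletWindow.AxialLogConvexity)
    (hW : ∀ (G : Type) [Group G] [TopologicalSpace G] [IsTopologicalGroup G] [CompactSpace G]
      [MeasurableSpace G] [BorelSpace G], IsCompactSimpleLieGroup G → ∀ r : LatticeRep G,
      ∀ ε : ℝ, 0 < ε → ∃ β₁ : ℝ, ∀ β : ℝ, β₁ ≤ β →
        ∀ μ ∈ infiniteVolumeLimitPoints (d := 4) r.ρ β, ∃ M : ℕ,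
          0 < plaquetteCorrFn r.ρ μ (((M + 2 : ℕ) : ℤ) • Pi.single (0 : Fin 4) (1 : ℤ)) ∧
          Real.exp (-(ε * (M + 1))) *
              plaquetteCorrFn r.ρ μ (((1 : ℕ) : ℤ) • Pi.single (0 : Fin 4) (1 : ℤ)) ≤
            plaquetteCorrFn r.ρ μ (((M + 2 : ℕ) : ℤ) • Pi.single (0 : Fin 4) (1 : ℤ))) :
    Theses.DirichletWindow.XiDiverges := by
  intro G _ _ _ _ _ _ hG r ε hε
  obtain ⟨β₁, hβ₁⟩ := hW G hG r ε hε
  refine ⟨max β₁ 0, fun β hβ μ hμ => ?_⟩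
  have hβ0 : 0 ≤ β := le_of_max_le_right hβ
  obtain ⟨M, hposM, hwinM⟩ := hβ₁ β (le_of_max_le_left hβ) μ hμ
  have hRP' := hRP G hG r β hβ0 μ hμ
  refine ⟨ε, _, hposM, hε.le, le_rfl, ?_⟩
  -- (elaborated stepwise: every implicit argument of the chord lemma is fixed before the
  -- plaquette terms are unified, which keeps `plaquetteCorrFn` folded)
  have key := xiDiverges_chord (ε := ε) (M := M)
    (a := fun k : ℕ => plaquetteCorrFn r.ρ μ ((k : ℤ) • Pi.single (0 : Fin 4) (1 : ℤ))) hε.le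
  have key₁ := key (fun n => (hRP' n).1) (fun n => (hRP' n).2.1) (fun n => (hRP' n).2.2.2)
  have key₂ := key₁ hposM hwinM
  exact key₂

/-- **The chord glue of both routes** (body of the glue item `XiDivergesOfFixedDistance`):
`AxialLogConvexity → FixedDistanceLower → PlaquetteVarianceUpper → XiDiverges`. Given `ε > 0`
pick the scale `n = M + 2 ≥ n₀` with `max(B,0) · n⁸ ≤ A e^{-ε} e^{ε n}` (a power is little-o of
an exponential); for `β ≥ max(β_n, β₁, 1)` and every limit state,
`e^{-ε (n-1)} f(e₀) ≤ e^{-ε (n-1)} f(0) ≤ e^{-ε (n-1)} B/β² ≤ A/(β² n⁸) ≤ f(n e₀)`, which is the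
one-scale window of `xiDiverges_of_window`. [folklore] -/
theorem xiDiverges_of_fixedDistanceLower
    (hRP : Theses.DirichletWindow.AxialLogConvexity)
    (hF : Theses.DirichletWindow.FixedDistanceLower)
    (hV : Theses.DirichletWindow.PlaquetteVarianceUpper) :
    Theses.DirichletWindow.XiDiverges := by
  refine xiDiverges_of_window hRP fun G _ _ _ _ _ _ hG r ε hε => ?_
  obtain ⟨A, n₀, hA, hF'⟩ := hF G hG r
  obtain ⟨B, βV, hV'⟩ := hV G hG r
  -- choice of the scale: `max B 0 * x ^ 8 ≤ A e^{-ε} e^{ε x}` eventually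
  have hev : ∀ᶠ x : ℝ in atTop, max B 0 * x ^ 8 ≤ A * Real.exp (-ε) * Real.exp (ε * x) := by
    have hc : 0 < A * Real.exp (-ε) / (max B 0 + 1) := by positivity
    filter_upwards [(isLittleO_pow_exp_pos_mul_atTop 8 hε).def hc, eventually_ge_atTop (0 : ℝ)]
      with x hx hx0
    rw [Real.norm_of_nonneg (pow_nonneg hx0 _), Real.norm_of_nonneg (Real.exp_pos _).le] at hx
    calc max B 0 * x ^ 8 ≤ max B 0 * (A * Real.exp (-ε) / (max B 0 + 1) * Real.exp (ε * x)) :=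
          mul_le_mul_of_nonneg_left hx (le_max_right _ _)
      _ = max B 0 / (max B 0 + 1) * (A * Real.exp (-ε) * Real.exp (ε * x)) := by ring
      _ ≤ 1 * (A * Real.exp (-ε) * Real.exp (ε * x)) := by
          refine mul_le_mul_of_nonneg_right ?_ (by positivity)
          rw [div_le_one (by positivity)]
          linarith [le_max_right B 0]
      _ = A * Real.exp (-ε) * Real.exp (ε * x) := one_mul _
  obtain ⟨n, hbound, hn₀, hn2⟩ := ((tendsto_natCast_atTop_atTop.eventually hev).and
    ((eventually_ge_atTop n₀).and (eventually_ge_atTop 2))).exists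
  obtain ⟨M, rfl⟩ : ∃ M, n = M + 2 := ⟨n - 2, by omega⟩
  obtain ⟨βF, hβF⟩ := hF' (M + 2) hn₀
  refine ⟨max (max βF βV) 1, fun β hβ μ hμ => ⟨M, ?_⟩⟩
  have hβF' : βF ≤ β := le_trans (le_max_left _ _) (le_trans (le_max_left _ _) hβ)
  have hβV' : βV ≤ β := le_trans (le_max_right _ _) (le_trans (le_max_left _ _) hβ)
  have hβ1 : 1 ≤ β := le_trans (le_max_right _ _) hβ
  have hβ0 : 0 ≤ β := zero_le_one.trans hβ1
  have hβsq : 0 < β ^ 2 := by positivity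
  have hlow := hβF β hβF' μ hμ
  have hvar := hV' β hβV' μ hμ
  have hRP' := hRP G hG r β hβ0 μ hμ
  have hnpos : (0 : ℝ) < ((M + 2 : ℕ) : ℝ) := by positivity
  have hAq : (0 : ℝ) < A / (β ^ 2 * ((M + 2 : ℕ) : ℝ) ^ 8) := by positivity
  have hpos := hAq.trans_le hlow
  refine ⟨hpos, ?_⟩
  -- `f(e₀) ≤ f(0) ≤ B / β²`
  have h10' := (hRP' 0).2.1
  have h00 : plaquetteCorrFn r.ρ μ (((0 : ℕ) : ℤ) • Pi.single (0 : Fin 4) (1 : ℤ)) =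
      plaquetteCorrFn r.ρ μ 0 := by
    congr 1
    simp
  have h10 := (h10'.trans_eq h00).trans hvar
  have hexp : Real.exp (-ε) * Real.exp (ε * ((M + 2 : ℕ) : ℝ)) * Real.exp (-(ε * (M + 1))) = 1 := by
    rw [← Real.exp_add, ← Real.exp_add]
    convert Real.exp_zero using 2
    push_cast
    ring
  -- the real-variable bookkeeping `e^{-ε (M+1)} B/β² ≤ A/(β² (M+2)⁸)`
  have harith : Real.exp (-(ε * (M + 1))) * (B / β ^ 2) ≤ A / (β ^ 2 * ((M + 2 : ℕ) : ℝ) ^ 8) := by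
    calc Real.exp (-(ε * (M + 1))) * (B / β ^ 2)
        ≤ Real.exp (-(ε * (M + 1))) * (max B 0 / β ^ 2) := by
          gcongr
          exact le_max_left _ _
      _ = max B 0 * ((M + 2 : ℕ) : ℝ) ^ 8 *
            (Real.exp (-(ε * (M + 1))) / (β ^ 2 * ((M + 2 : ℕ) : ℝ) ^ 8)) := by
          field_simp
      _ ≤ A * Real.exp (-ε) * Real.exp (ε * ((M + 2 : ℕ) : ℝ)) *
            (Real.exp (-(ε * (M + 1))) / (β ^ 2 * ((M + 2 : ℕ) : ℝ) ^ 8)) :=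
          mul_le_mul_of_nonneg_right hbound (by positivity)
      _ = A * (Real.exp (-ε) * Real.exp (ε * ((M + 2 : ℕ) : ℝ)) * Real.exp (-(ε * (M + 1)))) /
            (β ^ 2 * ((M + 2 : ℕ) : ℝ) ^ 8) := by
          ring
      _ = A / (β ^ 2 * ((M + 2 : ℕ) : ℝ) ^ 8) := by rw [hexp, mul_one]
  have hfin := (mul_le_mul_of_nonneg_left h10 (Real.exp_pos (-(ε * (M + 1)))).le).trans
    (harith.trans hlow)
  exact hfin

/-- **The exponential target implies the qualitative payoff**: route `XiCompleteMonotonicity`'s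
target `XiExpLowerBound` (rate `m ≤ K β e^{-c β}`) gives `XiDiverges`, because
`K β e^{-c β} ≤ ε` for all large `β` (a power is little-o of an exponential). [folklore] -/
theorem xiDiverges_of_xiExpLowerBound
    (hX : Theses.XiCompleteMonotonicity.XiExpLowerBound) :
    Theses.DirichletWindow.XiDiverges := by
  intro G _ _ _ _ _ _ hG r ε hε
  obtain ⟨β₀, c, K, hc, hX'⟩ := hX G hG r
  have hev : ∀ᶠ β : ℝ in atTop, K * β * Real.exp (-(c * β)) ≤ ε := by
    have hK : 0 < ε / (|K| + 1) := by positivity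
    filter_upwards [(isLittleO_pow_exp_pos_mul_atTop 1 hc).def hK, eventually_ge_atTop (0 : ℝ)]
      with β hβ hβ0
    rw [pow_one, Real.norm_of_nonneg hβ0, Real.norm_of_nonneg (Real.exp_pos _).le] at hβ
    have hone : Real.exp (c * β) * Real.exp (-(c * β)) = 1 := by
      rw [← Real.exp_add, add_neg_cancel, Real.exp_zero]
    calc K * β * Real.exp (-(c * β)) ≤ |K| * β * Real.exp (-(c * β)) := by
          gcongr
          exact le_abs_self K
      _ ≤ |K| * (ε / (|K| + 1) * Real.exp (c * β)) * Real.exp (-(c * β)) := by gcongr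
      _ = |K| / (|K| + 1) * ε * (Real.exp (c * β) * Real.exp (-(c * β))) := by ring
      _ = |K| / (|K| + 1) * ε := by rw [hone, mul_one]
      _ ≤ 1 * ε := by
          refine mul_le_mul_of_nonneg_right ?_ hε.le
          rw [div_le_one (by positivity)]
          linarith [abs_nonneg K]
      _ = ε := one_mul ε
  obtain ⟨β₁, hβ₁⟩ := (hev.and (eventually_ge_atTop β₀)).exists_forall_of_atTop
  refine ⟨β₁, fun β hβ μ hμ => ?_⟩
  obtain ⟨h1, h2⟩ := hβ₁ β hβ
  obtain ⟨m, A, hA, hm0, hmK, hdec⟩ := hX' β h2 μ hμ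
  exact ⟨m, A, hA, hm0, hmK.trans h1, hdec⟩

/-- **The polynomial window already gives the qualitative payoff** (body of route
`XiCompleteMonotonicity`'s glue item `XiDivergesOfPolynomial`):
`AxialLogConvexity → PolynomialWindow → XiDiverges`. At the scale `n = ⌊β^p⌋₊` the window gives
`f(n e₀) ≥ A/(β² n⁸)` while `f(e₀) ≤ N²` (reflection positivity); since `β² ≤ (n+1)^{2/p}`, the
one-scale condition `e^{-ε (n-1)} N² ≤ A/(β² n⁸)` reduces to
`(N²+1) (n+1)^{2/p+8} ≤ A e^{-2ε} e^{ε (n+1)}`, true for `n` large (a real power is little-o of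
an exponential), i.e. for `β` large. [folklore] -/
theorem xiDiverges_of_polynomialWindow
    (hRP : Theses.DirichletWindow.AxialLogConvexity)
    (hP : Theses.XiCompleteMonotonicity.PolynomialWindow) :
    Theses.DirichletWindow.XiDiverges := by
  refine xiDiverges_of_window hRP fun G _ _ _ _ _ _ hG r ε hε => ?_
  obtain ⟨β₀, p, A, n₀, hp, hA, hP'⟩ := hP G hG r
  -- choice of the scale threshold: `(N²+1) x^{2/p+8} ≤ A e^{-2ε} e^{ε x}` eventually
  have hev : ∀ᶠ x : ℝ in atTop, ((r.N : ℝ) ^ 2 + 1) * x ^ (2 / p + 8) ≤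
      A * Real.exp (-(2 * ε)) * Real.exp (ε * x) := by
    have hc : 0 < A * Real.exp (-(2 * ε)) / ((r.N : ℝ) ^ 2 + 1) := by positivity
    filter_upwards [(isLittleO_rpow_exp_pos_mul_atTop (2 / p + 8) hε).def hc,
      eventually_ge_atTop (0 : ℝ)] with x hx hx0
    rw [Real.norm_of_nonneg (Real.rpow_nonneg hx0 _), Real.norm_of_nonneg (Real.exp_pos _).le]
      at hx
    calc ((r.N : ℝ) ^ 2 + 1) * x ^ (2 / p + 8)
        ≤ ((r.N : ℝ) ^ 2 + 1) * (A * Real.exp (-(2 * ε)) / ((r.N : ℝ) ^ 2 + 1) * Real.exp (ε * x)) :=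
          mul_le_mul_of_nonneg_left hx (by positivity)
      _ = A * Real.exp (-(2 * ε)) * Real.exp (ε * x) := by
          field_simp
  have hevN : ∀ᶠ n : ℕ in atTop, ((r.N : ℝ) ^ 2 + 1) * ((n : ℝ) + 1) ^ (2 / p + 8) ≤
      A * Real.exp (-(2 * ε)) * Real.exp (ε * ((n : ℝ) + 1)) :=
    (tendsto_atTop_add_const_right atTop (1 : ℝ) tendsto_natCast_atTop_atTop).eventually hev
  obtain ⟨n₂, hn₂⟩ :=
    (hevN.and ((eventually_ge_atTop n₀).and (eventually_ge_atTop 2))).exists_forall_of_atTop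
  -- choice of `β₁`: `β ≥ max β₀ 1` and `β ^ p ≥ n₂`
  obtain ⟨β₁, hβ₁⟩ := (((tendsto_rpow_atTop hp).eventually_ge_atTop (n₂ : ℝ)).and
    (eventually_ge_atTop (max β₀ 1))).exists_forall_of_atTop
  refine ⟨β₁, fun β hβ μ hμ => ?_⟩
  obtain ⟨hβp, hβm⟩ := hβ₁ β hβ
  have hβ0' : β₀ ≤ β := (le_max_left _ _).trans hβm
  have hβ1 : 1 ≤ β := (le_max_right _ _).trans hβm
  have hβ0 : 0 ≤ β := zero_le_one.trans hβ1
  have hβp0 : 0 ≤ β ^ p := Real.rpow_nonneg hβ0 p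
  -- the scale `n = ⌊β^p⌋₊ = M + 2`
  set n : ℕ := ⌊β ^ p⌋₊ with hn
  have hnle : (n : ℝ) ≤ β ^ p := Nat.floor_le hβp0
  have hlt : β ^ p < (n : ℝ) + 1 := Nat.lt_floor_add_one _
  have hn₂n : n₂ ≤ n := Nat.le_floor hβp
  clear_value n
  obtain ⟨hbd, hn₀n, hn2⟩ := hn₂ n hn₂n
  obtain ⟨M, rfl⟩ : ∃ M, n = M + 2 := ⟨n - 2, by omega⟩
  refine ⟨M, ?_⟩
  have hlow := hP' β hβ0' μ hμ (M + 2) hn₀n hnle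
  have hRP' := hRP G hG r β hβ0 μ hμ
  have hAq : (0 : ℝ) < A / (β ^ 2 * ((M + 2 : ℕ) : ℝ) ^ 8) := by positivity
  have hpos := hAq.trans_le hlow
  refine ⟨hpos, ?_⟩
  have h1N := (hRP' 1).2.2.1
  -- the real-variable bookkeeping `e^{-ε (M+1)} N² ≤ A/(β² (M+2)⁸)`
  have hx0 : (0 : ℝ) < ((M + 2 : ℕ) : ℝ) + 1 := by positivity
  have hβ2 : β ^ 2 ≤ (((M + 2 : ℕ) : ℝ) + 1) ^ (2 / p) := by
    have h2 : β ^ (2 : ℝ) = (β ^ p) ^ (2 / p) := by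
      rw [← Real.rpow_mul hβ0]
      congr 1
      field_simp
    rw [← Real.rpow_natCast β 2, Nat.cast_ofNat, h2]
    exact Real.rpow_le_rpow hβp0 hlt.le (by positivity)
  have hn8 : ((M + 2 : ℕ) : ℝ) ^ 8 ≤ (((M + 2 : ℕ) : ℝ) + 1) ^ (8 : ℝ) := by
    rw [show (8 : ℝ) = ((8 : ℕ) : ℝ) by norm_num, Real.rpow_natCast]
    gcongr
    linarith
  have hprod : β ^ 2 * ((M + 2 : ℕ) : ℝ) ^ 8 ≤ (((M + 2 : ℕ) : ℝ) + 1) ^ (2 / p + 8) := by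
    rw [Real.rpow_add hx0]
    exact mul_le_mul hβ2 hn8 (by positivity) (Real.rpow_nonneg hx0.le _)
  have hexp : Real.exp (-(ε * (M + 1))) * Real.exp (-(2 * ε)) *
      Real.exp (ε * (((M + 2 : ℕ) : ℝ) + 1)) = 1 := by
    rw [← Real.exp_add, ← Real.exp_add]
    convert Real.exp_zero using 2
    push_cast
    ring
  have harith : Real.exp (-(ε * (M + 1))) * (r.N : ℝ) ^ 2 ≤
      A / (β ^ 2 * ((M + 2 : ℕ) : ℝ) ^ 8) := by
    rw [le_div_iff₀ (by positivity)]
    calc Real.exp (-(ε * (M + 1))) * (r.N : ℝ) ^ 2 * (β ^ 2 * ((M + 2 : ℕ) : ℝ) ^ 8)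
        ≤ Real.exp (-(ε * (M + 1))) * ((r.N : ℝ) ^ 2 + 1) *
            (((M + 2 : ℕ) : ℝ) + 1) ^ (2 / p + 8) := by
          refine mul_le_mul ?_ hprod (by positivity) (by positivity)
          exact mul_le_mul_of_nonneg_left (by linarith) (Real.exp_pos _).le
      _ = Real.exp (-(ε * (M + 1))) *
            (((r.N : ℝ) ^ 2 + 1) * (((M + 2 : ℕ) : ℝ) + 1) ^ (2 / p + 8)) := by ring
      _ ≤ Real.exp (-(ε * (M + 1))) *
            (A * Real.exp (-(2 * ε)) * Real.exp (ε * (((M + 2 : ℕ) : ℝ) + 1))) :=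
          mul_le_mul_of_nonneg_left hbd (Real.exp_pos _).le
      _ = A * (Real.exp (-(ε * (M + 1))) * Real.exp (-(2 * ε)) *
            Real.exp (ε * (((M + 2 : ℕ) : ℝ) + 1))) := by ring
      _ = A := by rw [hexp, mul_one]
  have hfin := (mul_le_mul_of_nonneg_left h1N (Real.exp_pos (-(ε * (M + 1)))).le).trans
    (harith.trans hlow)
  exact hfin

/-- The item is shared verbatim by the two routes: the two declarations `XiDiverges` agree
definitionally. [folklore] -/
theorem xiDiverges_iff_xiCompleteMonotonicity :
    Theses.DirichletWindow.XiDiverges ↔ Theses.XiCompleteMonotonicity.XiDiverges := Iff.rfl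

/-- **The glue item `XiDivergesOfFixedDistance` of route `DirichletWindow` holds** (its body is
`xiDiverges_of_fixedDistanceLower`). [folklore] -/
theorem xiDivergesOfFixedDistance_dirichletWindow :
    Theses.DirichletWindow.XiDivergesOfFixedDistance :=
  xiDiverges_of_fixedDistanceLower

/-- **The glue item `XiDivergesOfFixedDistance` of route `XiCompleteMonotonicity` holds.** [folklore] -/
theorem xiDivergesOfFixedDistance_xiCompleteMonotonicity :
    Theses.XiCompleteMonotonicity.XiDivergesOfFixedDistance :=
  xiDiverges_of_fixedDistanceLower

/-- **The glue item `XiDivergesOfPolynomial` of route `XiCompleteMonotonicity` holds** (its body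
is `xiDiverges_of_polynomialWindow`). [folklore] -/
theorem xiDivergesOfPolynomial_xiCompleteMonotonicity :
    Theses.XiCompleteMonotonicity.XiDivergesOfPolynomial :=
  xiDiverges_of_polynomialWindow

end Summit.QuantumFields.YangMills.Theorems
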